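import Summits.CriticalPhenomena.PercolationContinuityZ3.Theorems.Transplant.KNLevelsStepVAdditive
import Summits.CriticalPhenomena.PercolationContinuityZ3.Theorems.Transplant.KNLevelsAdditiveGluingTransfer
import Summits.CriticalPhenomena.PercolationContinuityZ3.Theorems.Transplant.KNLevelsTargetPropertyAdditive
import HarnessLib

/-!
# F6 (generic), part 7b — Kozma–Nitzan Lemma 10 ASSEMBLED in SOURCE-ADDITIVE form, and the additive target property UNCONDITIONALLY
# (NEG-SCOPE §B.19 (Q′-1), second half; design owner p3-g11)

builds on p205010 (kernel theorem, internal audit signed; external expert review pending) through `additiveGluingSchema_KN_in` (part 6,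
from `AdditiveGluing_proof`).  Lane `prim-bschramm`, seat `prim-bschramm-p3` (gen 11; N1 design owner); helper file
(`--supports stmt-CriticalPhenomena-4575`).

* `LHyp.stepII_additive` — Step II without a source hypothesis: some level `j` of the window has
  `P(≥ N contacts at j) ≥ P(o ↔ B⟨0⟩) − δ` (the proof of `LHyp.stepII` is already additive; only its last line changes);
* `targetLemma_additive_of_kits` — Steps I–V assembled: kits at accuracy `δ` on every level of a window with `(1−p)^{−ΔN} ≤ δ·#levels`
  and the additive gluing schema give **`P_W(o ↔ T) ≥ P_W(o ↔ B⟨0⟩) − 6δ`**;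
* **`additiveTargetPropertyUP_KN : AdditiveTargetPropertyUP V Δ`** (part 5's predicate, `C = 6`) for every countable `V` — unconditional;
* **`chain_edge_additive_KN`** — the unconditional additive chain estimate a closure consumes:
  `P_W(o ↔ T'_n) ≥ P_W(o ↔ X_0(0)) − (n + 1)(6δ + η)` for linked chains of `n + 1` target steps with kits at `δ ∈ (0, 1]` and excess `≤ η`,
  uniformly in `p < 1`, the graph (degrees `≤ Δ`) and the weighting — the SOURCE enters once, so the scheme threshold `δc` of KN's (32) no
  longer bounds the corridor length (NEG-SCOPE §B.19 (Q′-3): `nmax` may be chosen AFTER `K₀`).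
[cite: KozmaNitzan2024, §4 Lemma 10 (pp. 17–22), Lemma 11 (p. 22), Lemma 12 (pp. 23–25); Conjecture 1 (p. 3)] [this work]
-/

noncomputable section

open MeasureTheory ProbabilityTheory
open scoped ENNReal

namespace Summit.CriticalPhenomena.PercolationContinuityZ3.Theorems

namespace Transplant

namespace KNLevels

open Literature.Probability.Percolation Literature.Probability.LatticeModels SimpleGraph

variable {V : Type} [DecidableEq V] {G : SimpleGraph V} [G.LocallyFinite]

namespace LHyp

variable {L : LData G} {W : Sym2 V → unitInterval} {p : unitInterval} {D : Finset V} {R : ℕ}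
variable (hL : LHyp L W p D R)
include hL

open Classical in
/-- **Step II, source-additive** (KN p. 18): if the level range `J = [j₀, j₁]`, `j₁ ≤ R`, has at least `(1-p)^{-ΔN} / δ` levels, then at
some level `j ∈ J`, `P(≥ N contacts at j) ≥ P(o ↔ B⟨0⟩) − δ`.  (Proof of `LHyp.stepII` verbatim: `Σ_j P(o ↔ B, Fail_j) ≤ (1−p)^{−ΔN}`,
pigeonhole, `P(Fail_jᶜ) ≥ P(o ↔ B) − P(o ↔ B, Fail_j)`.) [cite: KozmaNitzan2024, §4 p. 18 (Step II)] [this work] -/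
theorem stepII_additive [Countable V] {Δ : ℕ} (hΔ : ∀ x, G.degree x ≤ Δ) (hp1 : (p : ℝ) < 1) {N j₀ j₁ : ℕ} (hj₁ : j₁ ≤ R) {δ : ℝ}
    (hJ : 1 / (1 - (p : ℝ)) ^ (Δ * N) ≤ δ * ((Finset.Icc j₀ j₁).card : ℝ)) :
    ∃ j ∈ Finset.Icc j₀ j₁, (prodBernoulli W).real L.reachB - δ ≤ (prodBernoulli W).real {ω | N ≤ (L.Kont j ω).card} := by
  simp only [← LData.compl_Fail_eq]
  set μ := prodBernoulli W with hμ
  set J := Finset.Icc j₀ j₁ with hJdef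
  have hJle : ∀ j ∈ J, j ≤ R := fun j hj => (Finset.mem_Icc.1 hj).2.trans hj₁
  set q : ℝ := (1 - (p : ℝ)) ^ (Δ * N) with hq
  have hq0 : 0 < q := pow_pos (by linarith) _
  have hq1 : q ≤ 1 := pow_le_one₀ (sub_nonneg.2 p.2.2) (sub_le_self _ p.2.1)
  set r : ℝ := 1 - q with hr
  have hr0 : 0 ≤ r := by rw [hr]; linarith
  have hr1 : r < 1 := by rw [hr]; linarith
  -- `J` is nonempty
  have hJne : J.Nonempty := by
    rw [← Finset.card_pos]
    by_contra h0
    push Not at h0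
    have : (J.card : ℝ) = 0 := by exact_mod_cast Nat.le_zero.1 h0
    rw [this, mul_zero] at hJ
    have : 0 < 1 / q := by positivity
    linarith
  -- tails: `P(o ↔ B, t ≤ #fails) ≤ r^t`
  have htail : ∀ t ∈ Finset.Icc 1 J.card,
      μ.real (L.reachB ∩ {ω | t ≤ (J.filter fun j => ω ∈ L.Fail N j).card}) ≤ r ^ t := by
    intro t ht
    have ht1 : 1 ≤ t := (Finset.mem_Icc.1 ht).1
    have hcov : L.reachB ∩ {ω | t ≤ (J.filter fun j => ω ∈ L.Fail N j).card} ⊆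
        L.Aev N J t ∪ (PosOnly W)ᶜ := by
      intro ω hω
      by_cases hpos : ω ∈ PosOnly W
      · exact Or.inl (hL.reachB_inter_subset_Aev hJle ht1 ⟨⟨hω.1, hpos⟩, hω.2⟩)
      · exact Or.inr hpos
    calc _ ≤ μ.real (L.Aev N J t ∪ (PosOnly W)ᶜ) := measureReal_mono hcov
      _ ≤ μ.real (L.Aev N J t) + μ.real (PosOnly W)ᶜ := measureReal_union_le _ _
      _ ≤ r ^ t := by rw [hμ, real_compl_posOnly W, add_zero]; exact hL.real_Aev_le hΔ hJle t
  -- the sum over levels is at most `1/q`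
  have hsum : ∑ j ∈ J, μ.real (L.reachB ∩ L.Fail N j) ≤ 1 / q := by
    rw [hμ, LData.sum_real_inter_Fail_eq (L := L) N J LData.measurableSet_reachB]
    calc _ ≤ ∑ t ∈ Finset.Icc 1 J.card, r ^ t := Finset.sum_le_sum htail
      _ ≤ ∑ t ∈ Finset.range (J.card + 1), r ^ t := by
          refine Finset.sum_le_sum_of_subset_of_nonneg (fun t ht => ?_) (fun t _ _ => pow_nonneg hr0 t)
          rw [Finset.mem_range]; rw [Finset.mem_Icc] at ht; omega
      _ = (r ^ (J.card + 1) - 1) / (r - 1) := geom_sum_eq hr1.ne _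
      _ ≤ 1 / q := by
          have e1 : (r ^ (J.card + 1) - 1) / (r - 1) = (1 - r ^ (J.card + 1)) / q := by
            have hq' : r - 1 = -q := by rw [hr]; ring
            rw [hq', div_neg, ← neg_div, neg_sub]
          rw [e1]
          exact div_le_div_of_nonneg_right (by linarith [pow_nonneg hr0 (J.card + 1)]) hq0.le
  -- some level has `P(o ↔ B, Fail_j) ≤ δ`
  obtain ⟨j, hj, hjle⟩ := Finset.exists_le_of_sum_le hJne
    (f := fun j => μ.real (L.reachB ∩ L.Fail N j)) (g := fun _ => (1 / q) / J.card) (by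
      rw [Finset.sum_const, nsmul_eq_mul, mul_div_cancel₀ _ (by exact_mod_cast hJne.card_pos.ne')]
      exact hsum)
  refine ⟨j, hj, ?_⟩
  have hjδ : μ.real (L.reachB ∩ L.Fail N j) ≤ δ := by
    refine hjle.trans ?_
    rw [div_le_iff₀ (by exact_mod_cast hJne.card_pos)]
    exact hJ
  -- `P(Fail_jᶜ) ≥ P(o ↔ B) - P(o ↔ B, Fail_j)`
  have hsplit : μ.real L.reachB ≤ μ.real (L.reachB ∩ L.Fail N j) + μ.real (L.Fail N j)ᶜ := by
    rw [← measureReal_inter_add_sdiff (s := L.reachB) (LData.measurableSet_Fail (L := L) N j)]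
    refine add_le_add le_rfl (measureReal_mono fun ω hω => hω.2)
  linarith

end LHyp

/-! ## §2 Lemma 10 assembled, source-additive -/

/-- **Kozma–Nitzan's Lemma 10 over the levels of `G`, SOURCE-ADDITIVE, from per-level kits** (Steps I–V; the graph-free skeleton of KN
pp. 17–22 with the ADDITIVE gluing schema in place of Conjecture 3).  Degrees `≤ Δ`, `p < 1`, `V` countable; level data `L` with
`LHyp L W p D R`, target `∅ ≠ T ⊆ D`, contact count `N`, window `[j₀, j₁]`, `j₁ ≤ R`, with `(1-p)^{-ΔN} ≤ δ·#[j₀, j₁]` for some `δ ≥ 0`; a kit at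
every level of the window at accuracy `δ`; the additive gluing schema for finitely supported weightings.  Then
`P_W(o ↔ T) ≥ P_W(o ↔ B⟨0⟩) − 6δ` — no hypothesis on the source. [cite: KozmaNitzan2024, §4 Lemma 10 (pp. 17–22)] [this work] -/
theorem targetLemma_additive_of_kits [Countable V] {Δ : ℕ} (hΔ : ∀ x, G.degree x ≤ Δ)
    (hAG : ∀ (w : Sym2 V → unitInterval) (Sf : Finset V), (∀ e : Sym2 V, (∃ x ∈ e, x ∉ Sf) → w e = 0) →
      ∀ (A T : Finset V) (o : V) (Rg : Set V) (t : ℝ), A ⊆ Sf → T ⊆ Sf → o ∈ Sf → T.Nonempty → 0 ≤ t →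
        (∀ a ∈ A, 1 - t ≤ (prodBernoulli w).real (⋃ t' ∈ T, openConnIn Rg a t')) →
          (prodBernoulli w).real (⋃ a ∈ A, openConn o a) - t ≤ (prodBernoulli w).real (⋃ t' ∈ T, openConn o t'))
    (p : unitInterval) (hp1 : (p : ℝ) < 1) {δ : ℝ} (hδ : 0 ≤ δ)
    (L : LData G) (W : Sym2 V → unitInterval) (D T : Finset V) (R N j₀ j₁ : ℕ)
    (hL : LHyp L W p D R) (hj : j₁ ≤ R) (hTD : T ⊆ D) (hTne : T.Nonempty)
    (hJ : 1 / (1 - (p : ℝ)) ^ (Δ * N) ≤ δ * ((Finset.Icc j₀ j₁).card : ℝ))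
    (hkits : ∀ j ∈ Finset.Icc j₀ j₁, ∃ (σ : SData V) (S : Finset V), SHyp L j σ ∧ σ.N ≤ N ∧
      (1 - (p : ℝ) ^ σ.sB) ^ σ.k ≤ δ ∧ S ⊆ L.X j ∧ S ⊆ D ∧
      (∀ x ∈ σ.K, ∀ e ∈ σ.seed x, e ∉ wireSet (↑S : Set V)) ∧ (∀ x ∈ σ.K, σ.face x ⊆ S) ∧
      (∀ x ∈ σ.K, 1 - 3 * δ ≤ (prodBernoulli W).real {ω | ∃ u ∈ σ.face x,
        1 - δ < (prodBernoulli (pinW W (wireSet (↑S : Set V)) ω)).real (⋃ t ∈ T, openConnIn (↑D : Set V) u t)})) :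
    (prodBernoulli W).real L.reachB - 6 * δ ≤ (prodBernoulli W).real (⋃ t ∈ T, openConn L.o t) := by
  -- Step II: the level
  obtain ⟨j, hjJ, hII⟩ := hL.stepII_additive hΔ hp1 hj hJ
  have hjR : j ≤ R := (Finset.mem_Icc.1 hjJ).2.trans hj
  obtain ⟨σ, S, hσ, hN, hIII, hSX, hSD, hSseed, hUS, hIV⟩ := hkits j hjJ
  -- Step II's output in the `Fail` form for `σ.N ≤ N`
  have hII' : (prodBernoulli W).real L.reachB - δ ≤ (prodBernoulli W).real (L.Fail σ.N j)ᶜ := by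
    refine hII.trans (measureReal_mono (fun ω hω => ?_) (measure_ne_top _ _))
    rw [LData.compl_Fail_eq]
    exact hN.trans hω
  -- the additive gluing schema in the required form: source `o`, relays reliable to `T` inside `D`
  have hAG' : ∀ (w : Sym2 V → unitInterval), FinSupp w L.Sfin → ∀ (A : Finset V), A ⊆ L.Sfin → ∀ t : ℝ, 0 ≤ t →
      (∀ a ∈ A, 1 - t ≤ (prodBernoulli w).real (⋃ t' ∈ T, openConnIn (↑D : Set V) a t')) →
      (prodBernoulli w).real (⋃ a ∈ A, openConn L.o a) - t ≤ (prodBernoulli w).real (⋃ t' ∈ T, openConn L.o t') :=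
    fun w hw A hA t ht haT => hAG w L.Sfin hw.zero A T L.o (↑D : Set V) t hA (hTD.trans hL.DS) hL.o_mem hTne ht haT
  -- Steps III–V, additive
  have hV := hL.stepV_additive (Rg := (↑D : Set V)) hσ hjR hSX hSD hSseed hδ hIII hUS hIV hAG'
  linarith

/-! ## §3 The source-additive target property, unconditionally; the additive chain estimate a closure consumes -/

/-- **The source-additive target property from the additive gluing schema** (`C = 6`). [cite: KozmaNitzan2024, §4 Lemma 10 (pp. 17–22)]
[this work] -/
theorem additiveTargetPropertyUP_of_schema [Countable V] {Δ : ℕ}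
    (hAG : ∀ (w : Sym2 V → unitInterval) (Sf : Finset V), (∀ e : Sym2 V, (∃ x ∈ e, x ∉ Sf) → w e = 0) →
      ∀ (A T : Finset V) (o : V) (Rg : Set V) (t : ℝ), A ⊆ Sf → T ⊆ Sf → o ∈ Sf → T.Nonempty → 0 ≤ t →
        (∀ a ∈ A, 1 - t ≤ (prodBernoulli w).real (⋃ t' ∈ T, openConnIn Rg a t')) →
          (prodBernoulli w).real (⋃ a ∈ A, openConn o a) - t ≤ (prodBernoulli w).real (⋃ t' ∈ T, openConn o t')) :
    AdditiveTargetPropertyUP V Δ := by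
  refine ⟨6, by norm_num, fun δ hδ _ p hp1 G _ hΔ L W D T R N j₀ j₁ hL hj hTD hTne hJ hkits => ?_⟩
  exact targetLemma_additive_of_kits hΔ hAG p hp1 hδ.le L W D T R N j₀ j₁ hL hj hTD hTne hJ hkits

/-- **THE SOURCE-ADDITIVE TARGET PROPERTY, UNCONDITIONALLY** (every countable vertex type, every degree bound `Δ`; constant `C = 6`) —
from the tree theorem `AdditiveGluing_proof` via `additiveGluingSchema_KN_in`.  builds on p205010 (kernel theorem, internal audit signed;
external expert review pending). [cite: KozmaNitzan2024, §4 Lemma 10 (pp. 17–22); Conjecture 1 (p. 3)] [this work] -/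
theorem additiveTargetPropertyUP_KN [Countable V] {Δ : ℕ} : AdditiveTargetPropertyUP V Δ :=
  additiveTargetPropertyUP_of_schema fun w Sf hw A T o Rg t hA hT ho hne ht haT =>
    additiveGluingSchema_KN_in w Sf hw A T o Rg t hA hT ho hne ht haT

/-- **The unconditional ADDITIVE CHAIN ESTIMATE** (the form the re-ordered N1 closure consumes, NEG-SCOPE §B.19 (Q′-3)): for every `n`, every
kit accuracy `δ ∈ (0, 1]`, every `p < 1`, every graph on `V` with degrees `≤ Δ`, every weighting and every linked chain of `n + 1` target
steps with true targets `T'_i ⊆ T_i`, kits at `δ` and excess `P_W(o ↔ T_i \ T'_i) ≤ η`: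
`P_W(o ↔ X_0(0)) − (n + 1)(6δ + η) ≤ P_W(o ↔ T'_n)`.  The length `n` and the accuracies `δ, η` are free of each other and of the source.
builds on p205010 (kernel theorem, internal audit signed; external expert review pending).
[cite: KozmaNitzan2024, §4 Lemma 11 (p. 22), Lemma 12 (pp. 23–25)] [this work] -/
theorem chain_edge_additive_KN [Countable V] {Δ : ℕ} :
    ∃ C : ℝ, 0 ≤ C ∧ ∀ (n : ℕ) ⦃δ : ℝ⦄, 0 < δ → δ ≤ 1 → ∀ (p : unitInterval), (p : ℝ) < 1 →
      ∀ (G : SimpleGraph V) [G.LocallyFinite], (∀ x, G.degree x ≤ Δ) →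
      ∀ (W : Sym2 V → unitInterval) (s : Fin (n + 1) → TStep G) (T' : Fin (n + 1) → Finset V) (η : ℝ),
      (∀ i : Fin (n + 1), (s i).L.o = (s 0).L.o) →
      (∀ i : Fin n, T' (Fin.castSucc i) ⊆ (s i.succ).L.X 0) →
      (∀ i : Fin (n + 1), T' i ⊆ (s i).T) →
      (∀ i : Fin (n + 1), (s i).KitsAt W p Δ δ) →
      (∀ i : Fin (n + 1), (prodBernoulli W).real (⋃ t ∈ (s i).T \ T' i, openConn (s 0).L.o t) ≤ η) →
        (prodBernoulli W).real (s 0).L.reachB - (n + 1 : ℕ) * (C * δ + η) ≤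
          (prodBernoulli W).real (⋃ t ∈ T' (Fin.last n), openConn (s 0).L.o t) :=
  (additiveTargetPropertyUP_KN (V := V) (Δ := Δ)).chain_edge_additive

/-- The same in the `1 − ε` shape: source at `1 − δs`, conclusion at `1 − (δs + (n+1)(Cδ + η))`. [this work] -/
theorem chain_edge_from_source_KN [Countable V] {Δ : ℕ} :
    ∃ C : ℝ, 0 ≤ C ∧ ∀ (n : ℕ) ⦃δ : ℝ⦄, 0 < δ → δ ≤ 1 → ∀ (δs : ℝ) (p : unitInterval), (p : ℝ) < 1 →
      ∀ (G : SimpleGraph V) [G.LocallyFinite], (∀ x, G.degree x ≤ Δ) →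
      ∀ (W : Sym2 V → unitInterval) (s : Fin (n + 1) → TStep G) (T' : Fin (n + 1) → Finset V) (η : ℝ),
      (∀ i : Fin (n + 1), (s i).L.o = (s 0).L.o) →
      (∀ i : Fin n, T' (Fin.castSucc i) ⊆ (s i.succ).L.X 0) →
      (∀ i : Fin (n + 1), T' i ⊆ (s i).T) →
      (∀ i : Fin (n + 1), (s i).KitsAt W p Δ δ) →
      (∀ i : Fin (n + 1), (prodBernoulli W).real (⋃ t ∈ (s i).T \ T' i, openConn (s 0).L.o t) ≤ η) →
      1 - δs < (prodBernoulli W).real (s 0).L.reachB →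
        1 - (δs + (n + 1 : ℕ) * (C * δ + η)) < (prodBernoulli W).real (⋃ t ∈ T' (Fin.last n), openConn (s 0).L.o t) :=
  (additiveTargetPropertyUP_KN (V := V) (Δ := Δ)).chain_edge_from_source

end KNLevels

end Transplant

end Summit.CriticalPhenomena.PercolationContinuityZ3.Theorems

end
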